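import Summits.QuantumFields.YangMills.Theorems.BalabanUVNodesN19AdditiveLinksDegreeBudget
import Summits.QuantumFields.YangMills.Theorems.BalabanUVNodesN19OscillatingLinksMomentDiscrepancy

/-!
# YM-DAG node N19 (= NE7 proper) — THE LAW-LEVEL (`W₁`) FACE FOR A GENERAL ADDITIVE LIPSCHITZ STATISTIC `Σ_iφ_i(x_i)`
# (laws on the cube agreeing on `Π_t`: `|∫h(Σ_iφ_i(x_i))dP − ∫h(Σ_iφ_i(x_i))dQ| ≤ 2·10⁴·K·d·log₂³t∕t` for every `K`-Lipschitz `h`)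

Cell `pub-ymgap`, HUMAN RULING D-0062 (Track A) ∕ D-0149 (work-bound push), R141 (C) wider-strategy seat `pub-ymgap-dag-n19-e` (strategy
s3 = ALTERNATIVE CURRENCY), generation g33, module 22 (lineage module 169).  Route `Summits/QuantumFields/YangMills/Theses/BalabanUVNodes.lean`,
cluster item K3⁸ «SpineGivenEndpointR13SepCoPHV» (stmt-QuantumFields-27366); filed `--supports` that item `--as helper` (it proves no registered
stub).  COUNT-NEUTRAL: [folklore] over the lineage BY NAME — module 160 `…N19AdditiveLinksDegreeBudget` (`exists_mvPolynomial_near_lipschitzLink_additive`),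
module 125 `…N19OscillatingLinksMomentDiscrepancy` (`abs_integral_sub_integral_le_of_near`); TOY laws under HYPOTHESES; no scheme object, no Theses
import; NOT a discharge claim.

CONTENT.  ★★ `abs_integral_lipschitzLink_additive_sub_le_of_moments`: for continuous `1`-Lipschitz `φ_i : [−1,1] → [0,1]`, probability laws `P, Q` on
`ℝ^ι` carried by `[−1,1]^ι` with EQUAL mixed moments of total degree `≤ t` (`t ≥ 2`), and `h` `K`-Lipschitz on `ℝ`:
`|∫h(Σ_iφ_i(x_i))dP − ∫h(Σ_iφ_i(x_i))dQ| ≤ 2·10⁴·K·d·(log₂t)³∕t` — module 153's `W₁` face for the whole composition class (module 125's transfer with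
module 160's polynomial).  No matching lower bound in general (`φ_i` linear is free); for `φ = |·|` module 137 gives `2d∕(π(9t+6))`.

HONEST FRAMING (binding).  Elementary and [folklore]; TOY laws under hypotheses; NO consumer in the DAG today (the seat's own currency map, degree
model); nothing of Bałaban's instantiated; NE7 NOT PRINTED, NOT proved; N19 NOT discharged; count-neutral.  One finite `T⁴` programme at fixed `ε`;
nothing continuum ∕ `ℝ⁴` ∕ OS ∕ mass-gap ∕ Clay.  0 `def` ∕ 0 `sorry`.
-/

noncomputable section

open Finset MeasureTheory
open scoped Real

namespace Summit.QuantumFields.YangMills.Theorems.BalabanUVNodesN19AdditiveLinksLaws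

open Summit.QuantumFields.YangMills.Theorems.BalabanUVNodesN19AdditiveLinksDegreeBudget (exists_mvPolynomial_near_lipschitzLink_additive)
open Summit.QuantumFields.YangMills.Theorems.BalabanUVNodesN19OscillatingLinksMomentDiscrepancy (abs_integral_sub_integral_le_of_near)

variable {ι : Type*} [Fintype ι] [Nonempty ι]
variable {φ : ι → ℝ → ℝ}
  (hφL : ∀ i, ∀ u v : ℝ, u ∈ Set.Icc (-1 : ℝ) 1 → v ∈ Set.Icc (-1 : ℝ) 1 → |φ i u - φ i v| ≤ 1 * |u - v|)
  (hφ0 : ∀ i, ∀ u : ℝ, u ∈ Set.Icc (-1 : ℝ) 1 → 0 ≤ φ i u) (hφ1 : ∀ i, ∀ u : ℝ, u ∈ Set.Icc (-1 : ℝ) 1 → φ i u ≤ 1) (hφc : ∀ i, Continuous (φ i))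
include hφL hφ0 hφ1 hφc

/-- ★★ **LAWS AGREEING ON `Π_t` INTEGRATE EVERY LIPSCHITZ LINK OF `Σ_iφ_i(x_i)` TO WITHIN `2·10⁴·K·d·log₂³t∕t`.**  Let `φ_i : ℝ → ℝ` be continuous,
`1`-Lipschitz with values in `[0,1]` on `[−1,1]`; `P, Q` probability laws on `ℝ^ι` carried by `[−1,1]^ι` with equal mixed moments of total degree
`≤ t` (`t ≥ 2`); `h : ℝ → ℝ` with `|h(s) − h(s′)| ≤ K|s − s′|` on `ℝ` (`K ≥ 0`).  Then
`|∫h(Σ_iφ_i(x_i))dP − ∫h(Σ_iφ_i(x_i))dQ| ≤ 2·10⁴·K·d·(log₂t)³∕t`. [folklore] -/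
theorem abs_integral_lipschitzLink_additive_sub_le_of_moments {P Q : Measure (ι → ℝ)} [IsProbabilityMeasure P] [IsProbabilityMeasure Q]
    (hP : P (Set.pi Set.univ (fun _ : ι => Set.Icc (-1 : ℝ) 1))ᶜ = 0) (hQ : Q (Set.pi Set.univ (fun _ : ι => Set.Icc (-1 : ℝ) 1))ᶜ = 0)
    {t : ℕ} (ht : 2 ≤ t) (hmom : ∀ j : ι → ℕ, ∑ i, j i ≤ t → ∫ x, ∏ i, x i ^ j i ∂P = ∫ x, ∏ i, x i ^ j i ∂Q)
    {h : ℝ → ℝ} {K : ℝ} (hK0 : 0 ≤ K) (hK : ∀ s s', |h s - h s'| ≤ K * |s - s'|) :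
    |∫ x, h (∑ i, φ i (x i)) ∂P - ∫ x, h (∑ i, φ i (x i)) ∂Q| ≤ 2 * (10000 * K * Fintype.card ι * Real.logb 2 t ^ 3 / t) := by
  obtain ⟨F, hF, happ⟩ := exists_mvPolynomial_near_lipschitzLink_additive hφL hφ0 hφ1 hK0 (fun s s' _ _ => hK s s') ht
  have hLip : LipschitzWith (Real.toNNReal K) h := by
    refine LipschitzWith.of_dist_le_mul fun x y => ?_
    rw [Real.dist_eq, Real.dist_eq, Real.coe_toNNReal _ hK0]
    exact hK x y
  have hTc : Continuous fun x : ι → ℝ => ∑ i, φ i (x i) := continuous_finsetSum _ fun i _ => (hφc i).comp (continuous_apply i)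
  have hg : Continuous fun x : ι → ℝ => h (∑ i, φ i (x i)) := hLip.continuous.comp hTc
  exact abs_integral_sub_integral_le_of_near hP hQ hmom hg hF happ

end Summit.QuantumFields.YangMills.Theorems.BalabanUVNodesN19AdditiveLinksLaws

end
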